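import Summits.BirchSwinnertonDyer.BirchSwinnertonDyer.Theorems.ByReductionTypeAtTwoMultUpperHalfTowerTorsionCert
import HarnessLib

/-!
# Route `ByReductionTypeAtTwo`, crux `MultUpperHalfAtTwo` (item stmt-BirchSwinnertonDyer-19922): the TOWER road WITH RATIONAL
# `2`-TORSION — part 3: the constant AT the multiplicative `2` from PRINT (non-split `4` / split `2^{k_q}`), the torsion
# count a DECIDABLE point count at a good odd prime, and the UPPER HALF for the CLASS with the period datum DISPLAYED —
# what a per-class file of a «neither» class applies

HONEST FRAMING (cell `bsd-2adic`, run/shared/lean/pub/bsd-2adic/, seat `bsd-2adic-mult-2` GEN 5, HUMAN RULING D-0074 row (A)):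
research route; THEOREMS ONLY (no definition, no new named fact); nothing is booked; BSD is not proved by any of this.
PARTITION: X5@2 mult (K4ᵐ, RESIDUAL-MAP B1·O1; 1 976 book230 classes) × p = 2 — types-the-object-of (the per-class certificate
format of the TOWER road on the 142 «neither» rank-`0` classes of the residual of the line `four_roads`: the `X₀(N)`-optimal
member `E₀` has a rational `2`-torsion point that is neither ramified at `2` nor odd — Greenberg §5 —, `#E₀(ℚ)_tors = 2` on
141 of them, `Ш_an(E₀) ∈ {16, 64}`; 44 split / 98 non-split at `2`); closes none. bears_on: K4 (route-BirchSwinnertonDyer-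
ByReductionTypeAtTwo item 19922).

* §3 `towerGapAtTwo_of_layerSelmer_cert_{nonsplit,split}Two_of_torsion` — parts 1–2 (`MultTowerTorsion.…_cert_atTwo_of_torsion`)
  with the datum at `2` from PRINT exactly as GEN 4's `MultTowerCert.towerGapAtTwo_of_layerSelmer_cert_{nonsplit,split}Two`
  (`hNS2` Greenberg p. 93 ⟹ `C₂ = 4`; `hSP` pp. 92–93 + the Tate certificate `ord₂(log₂ q_E) ≤ k_q + 2` ⟹ `C₂ = 2^{k_q}`),
  any lower layer `j` (torsion count `htor` displayed) — and `…_of_goodPrime`: lower layer `ℚ` (`j = 0`), `hB` from the PRINT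
  named fact `Greenberg1999.finite_torsion_cyclotomicZpExtension` (Greenberg LNM 1716 §1 / Imai / Ribet), and the torsion count
  `#E[2^∞]^{Γ_ℚ} ≤ 2^t` DISCHARGED by a good odd prime `ℓ ≥ 3` with `#Ẽ(𝔽_ℓ) = n`, `¬ 2^{t+1} ∣ n` (ord-2 KitD
  `natCard_fixedPoints_geomPrimaryTorsion_le_pow_of_good`, Silverman VII.3.1(b); kernel-decidable on an integer model).
* §4 `missingUpperBoundAt_two_mult_of_layerSelmer_cert_{nonsplit,split}Two_of_goodPrime` (+ `_self`) — the UPPER HALF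
  `MissingUpperBoundAt W 2` at every member of a rank-`0` multiplicative-at-`2` class from a member `W₁` carrying the §3
  certificate and a DISPLAYED period datum (a lattice-optimal parametrisation datum at level `N_{W₁}` — Cremona optimality,
  Česnavičius — or `0 ≤ ord₂ ϖ` itself): GEN 3's class theorem `missingUpperBoundAt_two_mult_of_towerGapMember'` (PRINT
  {guarded Thm-4.1 analogue `h41ns'`, A236 `h41sp`, `hmod`, `hGZK`, `hCassels`, `hC`} + MEMO {`hKato` K11a RC-2, `hGS` RC-4}).

WHAT IS DISPLAYED, NOT PROVED: PRINT {`h33g`, `hM`, `hA`, `hNS2` | `hSP` (+ `hBDGP` for `log₂ q ≠ 0`), `hBtors` =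
`finite_torsion_cyclotomicZpExtension`, `h41ns'`, `h41sp`, `hmod`, `hGZK`, `hCassels`, `hC`}; MEMO {`hKato`, `hGS`}; CERTIFICATES
{`hlow`, `hup` (tower-eng ENGINE A + mult-3 node patch; kit j256117 of this seat, ONE engine today), the point count at `ℓ`, the
Tate certificate (split), the period / optimality datum `hPer`, `P`, `C`, `e`, `k`, arithmetic}. ∀-LEVEL CONTENT: none.

References: R. Greenberg, LNM 1716 (1999), §1 pp. 60–62, §3 pp. 85–94, §4 Lemma 4.3 and pp. 112–113; J. Silverman, AEC,
VII.3.1(b), VII.5.1; K. Česnavičius (2018) Thm. 1.2; J. W. S. Cassels, Arithmetic VIII (1965); R. L. Miller, LMS JCM 14 (2011)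
Def. 1.1; K. Ribet, appendix to Katz–Lang (1981); K. Barré-Sirieix, G. Diaz, F. Gramain, G. Philibert, Invent. Math. 124 (1996).
-/

set_option autoImplicit false
-- the Theorems namespace of this sub repeats the summit name by design (D-0017 nested layout: Summit.<S>.<Sub>)
set_option linter.dupNamespace false

noncomputable section

open scoped Classical MatrixGroups ModularForm

open NumberField IsDedekindDomain CongruenceSubgroup WeierstrassCurve Literature.NumberTheory.EllipticCurves
  Literature.NumberTheory.EllipticCurves.ModularForms
  Literature.NumberTheory.EllipticCurves.Greenberg1999
  Literature.NumberTheory.EllipticCurves.Rank1Residual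
  Literature.NumberTheory.EllipticCurves.Rank1Residual.Typed
  Literature.NumberTheory.GaloisRepresentations
  Summit.BirchSwinnertonDyer.Rank1Residual.X5 Summit.BirchSwinnertonDyer.Rank1Residual.X5.O1
  Summit.BirchSwinnertonDyer.Rank1Residual.X5.TowerGap
  Summit.BirchSwinnertonDyer.Rank1Residual
  Summit.BirchSwinnertonDyer.BirchSwinnertonDyer.Theorems.KatoHalfPinch
  Rat.HeightOneSpectrum

namespace Summit.BirchSwinnertonDyer.BirchSwinnertonDyer.Theorems.MultTowerTorsion

/-! ## §3 The gap certificate at a multiplicative `2` with rational `2`-torsion -/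

section Gap

variable (W : WeierstrassCurve ℚ) [W.IsElliptic] [W.IsGloballyMinimal]

/-- **The torsion count at layer `0` from a good odd prime**: `#E[2^∞]^{Gal(ℚ̄/ℚ_0)} = #E[2^∞]^{Γ_ℚ} ≤ 2^t` whenever a good
prime `ℓ ≥ 3` has `#Ẽ(𝔽_ℓ) = n` with `¬ 2^{t+1} ∣ n` (`E(ℚ)[2^∞] ↪ Ẽ(𝔽_ℓ)`, ord-2 KitD). [cite: SilvermanAEC2009, VII.3 Prop. 3.1(b)]
[cite: GreenbergLNM1716, §4 Lemma 4.3 (p. 103)] -/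
theorem natCard_fixedBy_layerSubgroup_zero_le_of_goodPrime (ℓ : ℕ) [Fact ℓ.Prime] (h3 : 3 ≤ ℓ)
    (hgood : W.HasGoodReductionAtPrime ℓ) {t n : ℕ} (hn : W.reductionPointCount ℓ = n) (hndvd : ¬ 2 ^ (t + 1) ∣ n)
    (κ : ZpExtension ℚ 2) :
    Nat.card {m : geomPrimaryTorsion W 2 | ∀ σ ∈ κ.layerSubgroup 0, σ • m = m} ≤ 2 ^ t := by
  haveI : NeZero ℓ := ⟨(Fact.out : ℓ.Prime).ne_zero⟩
  have hn0 : n ≠ 0 := hn ▸ (reductionPointCount_pos W ℓ).ne'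
  rw [W.natCard_fixedBy_layerSubgroup_zero_eq κ]
  exact TowerClass.natCard_fixedPoints_geomPrimaryTorsion_le_pow_of_good W 2 ℓ h3 hgood
    (hn ▸ TowerClass.padicValNat_le_of_not_pow_succ_dvd hn0 hndvd)

/-- **The GAP certificate at a NON-SPLIT multiplicative `2`, rational `2`-torsion allowed** (any lower layer `j`; the torsion
count `htor` and the finiteness `hB` displayed): part 2's `…_cert_atTwo_of_torsion` with `C₂ = 4` from PRINT `hNS2`.
[cite: GreenbergLNM1716, §3 pp. 85–94 (Lemmas 3.3–3.5; between Prop. 3.6 and 3.7, PDF p. 93)] [cite: SilvermanAEC2009, VII.1 Prop. 1.3, VII.5.1] -/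
theorem towerGapAtTwo_of_layerSelmer_cert_nonsplitTwo_of_torsion
    (h33g : lemma33_localTowerKerPrimary_eq_bot_of_good.{0})
    (hM : lemma33_localTowerKerPrimary_cyclic_of_multiplicative.{0})
    (hA : lemma33_natCard_localTowerKerPrimary_le_four_of_additive.{0})
    (hNS2 : sec3_natCard_localTowerKerPrimary_le_four_nonsplitMultiplicative_two)
    (hmult : W.HasMultiplicativeReductionAtPrime 2) (hns : ¬ W.HasSplitMultiplicativeReductionAtPrime 2)
    (hB : ∀ κ : ZpExtension ℚ 2, κ.IsCyclotomic →
      Finite (FixedPoints.addSubgroup κ.kerSubgroup (geomPrimaryTorsion W 2)))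
    {j j' a d t : ℕ} (hjj' : j ≤ j')
    (htor : ∀ κ : ZpExtension ℚ 2, κ.IsCyclotomic →
      Nat.card {m : geomPrimaryTorsion W 2 | ∀ σ ∈ κ.layerSubgroup j, σ • m = m} ≤ 2 ^ t)
    (P : Finset ℕ) (hP : ∀ ℓ ∈ P, ℓ.Prime ∧ ℓ ≠ 2)
    (hΔ : ∀ ℓ : ℕ, ℓ.Prime → ℓ ≠ 2 → (ℓ : ℤ) ∣ W.minimalDiscriminantInt → ℓ ∈ P)
    (C e k : ℕ → ℕ) (he : ∀ ℓ ∈ P, ¬ 2 ^ (e ℓ + 4) ∣ ℓ ^ 2 - 1)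
    (hC : ∀ (ℓ : ℕ) [Fact ℓ.Prime], ℓ ∈ P →
      4 ≤ C ℓ ∨ (W.HasMultiplicativeReductionAtPrime ℓ ∧ 2 ≤ C ℓ) ∨
        (W.HasMultiplicativeReductionAtPrime ℓ ∧ (ℓ : ℤ) ^ k ℓ ∣ W.minimalDiscriminantInt ∧
          ¬ (ℓ : ℤ) ^ (k ℓ + 1) ∣ W.minimalDiscriminantInt ∧ ¬ 2 ∣ k ℓ ∧ 1 ≤ C ℓ) ∨
        (¬ (ℓ : ℤ) ∣ W.minimalDiscriminantInt ∧ 1 ≤ C ℓ))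
    (hlow : ∀ κ : ZpExtension ℚ 2, κ.IsCyclotomic →
      2 ^ a ≤ Nat.card {z : W.selmerLayer κ j // 2 • z = 0})
    (hup : ∀ κ : ZpExtension ℚ 2, κ.IsCyclotomic →
      Nat.card {z : W.selmerLayer κ j' // 2 • z = 0} ≤ 2 ^ d)
    (harith : 2 ^ (d + t) * 4 * ∏ ℓ ∈ P, C ℓ ^ 2 ^ min j' (e ℓ) < 2 ^ (2 ^ j' - 2 ^ j + a)) :
    TowerGapAtTwo W :=
  towerGapAtTwo_of_layerSelmer_cert_atTwo_of_torsion W h33g hM hA hB hjj' htor 4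
    (MultTowerCert.atTwo_le_four_of_nonsplit W hNS2 hmult hns j') P hP hΔ C e k he hC hlow hup harith

/-- **The GAP certificate at a SPLIT multiplicative `2`, rational `2`-torsion allowed** (any lower layer `j`): part 2's
`…_cert_atTwo_of_torsion` with `C₂ = 2^{k_q}` from PRINT `hSP` and the Tate certificate `ord₂(log₂ q_E) ≤ k_q + 2` (`log₂ q_E ≠ 0`
displayed). [cite: GreenbergLNM1716, §3 pp. 85–94 (Lemmas 3.3–3.5; between Prop. 3.6 and 3.7, PDF pp. 92–93)]
[cite: SilvermanAEC2009, VII.1 Prop. 1.3, VII.5.1] -/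
theorem towerGapAtTwo_of_layerSelmer_cert_splitTwo_of_torsion
    (h33g : lemma33_localTowerKerPrimary_eq_bot_of_good.{0})
    (hM : lemma33_localTowerKerPrimary_cyclic_of_multiplicative.{0})
    (hA : lemma33_natCard_localTowerKerPrimary_le_four_of_additive.{0})
    (hSP : sec3_natCard_localTowerKerPrimary_splitMultiplicative_rat)
    (Dq : TateParameterData W 2) (hlog : padicLog 2 Dq.q ≠ 0) {kq : ℕ}
    (hkq : (padicLog 2 Dq.q).valuation ≤ (kq : ℤ) + 2)
    (hB : ∀ κ : ZpExtension ℚ 2, κ.IsCyclotomic →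
      Finite (FixedPoints.addSubgroup κ.kerSubgroup (geomPrimaryTorsion W 2)))
    {j j' a d t : ℕ} (hjj' : j ≤ j')
    (htor : ∀ κ : ZpExtension ℚ 2, κ.IsCyclotomic →
      Nat.card {m : geomPrimaryTorsion W 2 | ∀ σ ∈ κ.layerSubgroup j, σ • m = m} ≤ 2 ^ t)
    (P : Finset ℕ) (hP : ∀ ℓ ∈ P, ℓ.Prime ∧ ℓ ≠ 2)
    (hΔ : ∀ ℓ : ℕ, ℓ.Prime → ℓ ≠ 2 → (ℓ : ℤ) ∣ W.minimalDiscriminantInt → ℓ ∈ P)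
    (C e k : ℕ → ℕ) (he : ∀ ℓ ∈ P, ¬ 2 ^ (e ℓ + 4) ∣ ℓ ^ 2 - 1)
    (hC : ∀ (ℓ : ℕ) [Fact ℓ.Prime], ℓ ∈ P →
      4 ≤ C ℓ ∨ (W.HasMultiplicativeReductionAtPrime ℓ ∧ 2 ≤ C ℓ) ∨
        (W.HasMultiplicativeReductionAtPrime ℓ ∧ (ℓ : ℤ) ^ k ℓ ∣ W.minimalDiscriminantInt ∧
          ¬ (ℓ : ℤ) ^ (k ℓ + 1) ∣ W.minimalDiscriminantInt ∧ ¬ 2 ∣ k ℓ ∧ 1 ≤ C ℓ) ∨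
        (¬ (ℓ : ℤ) ∣ W.minimalDiscriminantInt ∧ 1 ≤ C ℓ))
    (hlow : ∀ κ : ZpExtension ℚ 2, κ.IsCyclotomic →
      2 ^ a ≤ Nat.card {z : W.selmerLayer κ j // 2 • z = 0})
    (hup : ∀ κ : ZpExtension ℚ 2, κ.IsCyclotomic →
      Nat.card {z : W.selmerLayer κ j' // 2 • z = 0} ≤ 2 ^ d)
    (harith : 2 ^ (d + t) * 2 ^ kq * ∏ ℓ ∈ P, C ℓ ^ 2 ^ min j' (e ℓ) < 2 ^ (2 ^ j' - 2 ^ j + a)) :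
    TowerGapAtTwo W :=
  towerGapAtTwo_of_layerSelmer_cert_atTwo_of_torsion W h33g hM hA hB hjj' htor (2 ^ kq)
    (MultTowerCert.atTwo_le_pow_of_split W hSP Dq hlog
      (by rw [MultTowerCert.padicValNat_two_four]; exact_mod_cast hkq) j')
    P hP hΔ C e k he hC hlow hup harith

/-- **The GAP certificate at a NON-SPLIT multiplicative `2`, lower layer `ℚ`, every datum PRINT or decidable**: `hB` from the
PRINT named fact `hBtors = Greenberg1999.finite_torsion_cyclotomicZpExtension`, the torsion count from a good prime `ℓ ≥ 3` with
`#Ẽ(𝔽_ℓ) = n`, `¬ 2^{t+1} ∣ n`; arithmetic `2^{d+t} · 4 · ∏_{ℓ∈P} C_ℓ^{2^{min(j', e_ℓ)}} < 2^{2^{j'} − 1 + a}`.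
[cite: GreenbergLNM1716, §1 p. 62, §3 pp. 85–94, §4 Lemma 4.3] [cite: SilvermanAEC2009, VII.3 Prop. 3.1(b), VII.5.1]
[cite: Ribet1981KatzLangAppendix, Theorem (p. 315)] -/
theorem towerGapAtTwo_of_layerSelmer_cert_nonsplitTwo_of_goodPrime
    (h33g : lemma33_localTowerKerPrimary_eq_bot_of_good.{0})
    (hM : lemma33_localTowerKerPrimary_cyclic_of_multiplicative.{0})
    (hA : lemma33_natCard_localTowerKerPrimary_le_four_of_additive.{0})
    (hNS2 : sec3_natCard_localTowerKerPrimary_le_four_nonsplitMultiplicative_two)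
    (hBtors : finite_torsion_cyclotomicZpExtension)
    (hmult : W.HasMultiplicativeReductionAtPrime 2) (hns : ¬ W.HasSplitMultiplicativeReductionAtPrime 2)
    (ℓ₀ : ℕ) [Fact ℓ₀.Prime] (h3 : 3 ≤ ℓ₀) (hgood : W.HasGoodReductionAtPrime ℓ₀) {t n : ℕ}
    (hn : W.reductionPointCount ℓ₀ = n) (hndvd : ¬ 2 ^ (t + 1) ∣ n) {j' a d : ℕ}
    (P : Finset ℕ) (hP : ∀ ℓ ∈ P, ℓ.Prime ∧ ℓ ≠ 2)
    (hΔ : ∀ ℓ : ℕ, ℓ.Prime → ℓ ≠ 2 → (ℓ : ℤ) ∣ W.minimalDiscriminantInt → ℓ ∈ P)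
    (C e k : ℕ → ℕ) (he : ∀ ℓ ∈ P, ¬ 2 ^ (e ℓ + 4) ∣ ℓ ^ 2 - 1)
    (hC : ∀ (ℓ : ℕ) [Fact ℓ.Prime], ℓ ∈ P →
      4 ≤ C ℓ ∨ (W.HasMultiplicativeReductionAtPrime ℓ ∧ 2 ≤ C ℓ) ∨
        (W.HasMultiplicativeReductionAtPrime ℓ ∧ (ℓ : ℤ) ^ k ℓ ∣ W.minimalDiscriminantInt ∧
          ¬ (ℓ : ℤ) ^ (k ℓ + 1) ∣ W.minimalDiscriminantInt ∧ ¬ 2 ∣ k ℓ ∧ 1 ≤ C ℓ) ∨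
        (¬ (ℓ : ℤ) ∣ W.minimalDiscriminantInt ∧ 1 ≤ C ℓ))
    (hlow : ∀ κ : ZpExtension ℚ 2, κ.IsCyclotomic →
      2 ^ a ≤ Nat.card {z : W.selmerLayer κ 0 // 2 • z = 0})
    (hup : ∀ κ : ZpExtension ℚ 2, κ.IsCyclotomic →
      Nat.card {z : W.selmerLayer κ j' // 2 • z = 0} ≤ 2 ^ d)
    (harith : 2 ^ (d + t) * 4 * ∏ ℓ ∈ P, C ℓ ^ 2 ^ min j' (e ℓ) < 2 ^ (2 ^ j' - 1 + a)) :
    TowerGapAtTwo W :=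
  towerGapAtTwo_of_layerSelmer_cert_nonsplitTwo_of_torsion W h33g hM hA hNS2 hmult hns (fun κ hκ ↦ hBtors W 2 κ hκ)
    (Nat.zero_le j') (fun κ _ ↦ natCard_fixedBy_layerSubgroup_zero_le_of_goodPrime W ℓ₀ h3 hgood hn hndvd κ)
    P hP hΔ C e k he hC hlow hup (by rw [pow_zero]; exact harith)

/-- **The GAP certificate at a SPLIT multiplicative `2`, lower layer `ℚ`, every datum PRINT or decidable** (as the non-split
door with `hSP` + the Tate certificate; arithmetic `2^{d+t} · 2^{k_q} · ∏ C_ℓ^{…} < 2^{2^{j'} − 1 + a}`).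
[cite: GreenbergLNM1716, §1 p. 62, §3 pp. 85–94, §4 Lemma 4.3] [cite: SilvermanAEC2009, VII.3 Prop. 3.1(b), VII.5.1]
[cite: Ribet1981KatzLangAppendix, Theorem (p. 315)] -/
theorem towerGapAtTwo_of_layerSelmer_cert_splitTwo_of_goodPrime
    (h33g : lemma33_localTowerKerPrimary_eq_bot_of_good.{0})
    (hM : lemma33_localTowerKerPrimary_cyclic_of_multiplicative.{0})
    (hA : lemma33_natCard_localTowerKerPrimary_le_four_of_additive.{0})
    (hSP : sec3_natCard_localTowerKerPrimary_splitMultiplicative_rat)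
    (hBtors : finite_torsion_cyclotomicZpExtension)
    (Dq : TateParameterData W 2) (hlog : padicLog 2 Dq.q ≠ 0) {kq : ℕ}
    (hkq : (padicLog 2 Dq.q).valuation ≤ (kq : ℤ) + 2)
    (ℓ₀ : ℕ) [Fact ℓ₀.Prime] (h3 : 3 ≤ ℓ₀) (hgood : W.HasGoodReductionAtPrime ℓ₀) {t n : ℕ}
    (hn : W.reductionPointCount ℓ₀ = n) (hndvd : ¬ 2 ^ (t + 1) ∣ n) {j' a d : ℕ}
    (P : Finset ℕ) (hP : ∀ ℓ ∈ P, ℓ.Prime ∧ ℓ ≠ 2)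
    (hΔ : ∀ ℓ : ℕ, ℓ.Prime → ℓ ≠ 2 → (ℓ : ℤ) ∣ W.minimalDiscriminantInt → ℓ ∈ P)
    (C e k : ℕ → ℕ) (he : ∀ ℓ ∈ P, ¬ 2 ^ (e ℓ + 4) ∣ ℓ ^ 2 - 1)
    (hC : ∀ (ℓ : ℕ) [Fact ℓ.Prime], ℓ ∈ P →
      4 ≤ C ℓ ∨ (W.HasMultiplicativeReductionAtPrime ℓ ∧ 2 ≤ C ℓ) ∨
        (W.HasMultiplicativeReductionAtPrime ℓ ∧ (ℓ : ℤ) ^ k ℓ ∣ W.minimalDiscriminantInt ∧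
          ¬ (ℓ : ℤ) ^ (k ℓ + 1) ∣ W.minimalDiscriminantInt ∧ ¬ 2 ∣ k ℓ ∧ 1 ≤ C ℓ) ∨
        (¬ (ℓ : ℤ) ∣ W.minimalDiscriminantInt ∧ 1 ≤ C ℓ))
    (hlow : ∀ κ : ZpExtension ℚ 2, κ.IsCyclotomic →
      2 ^ a ≤ Nat.card {z : W.selmerLayer κ 0 // 2 • z = 0})
    (hup : ∀ κ : ZpExtension ℚ 2, κ.IsCyclotomic →
      Nat.card {z : W.selmerLayer κ j' // 2 • z = 0} ≤ 2 ^ d)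
    (harith : 2 ^ (d + t) * 2 ^ kq * ∏ ℓ ∈ P, C ℓ ^ 2 ^ min j' (e ℓ) < 2 ^ (2 ^ j' - 1 + a)) :
    TowerGapAtTwo W :=
  towerGapAtTwo_of_layerSelmer_cert_splitTwo_of_torsion W h33g hM hA hSP Dq hlog hkq (fun κ hκ ↦ hBtors W 2 κ hκ)
    (Nat.zero_le j') (fun κ _ ↦ natCard_fixedBy_layerSubgroup_zero_le_of_goodPrime W ℓ₀ h3 hgood hn hndvd κ)
    P hP hΔ C e k he hC hlow hup (by rw [pow_zero]; exact harith)

end Gap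

/-! ## §4 The UPPER HALF for a multiplicative-at-`2` class from a member WITH rational `2`-torsion (period datum displayed) -/

section UpperHalf

/-- **ROAD (tower) for the CLASS at a NON-SPLIT member with rational `2`-torsion — what a per-class file of a «neither»
class applies.** For `W/ℚ` of analytic rank `0` multiplicative at `2` and a `ℚ`-isogenous globally minimal member `W₁`
NON-SPLIT multiplicative at `2` carrying (a) the §3 certificate (lower layer `ℚ`, torsion count from the good prime `ℓ₀`) and
(b) a DISPLAYED period datum `hPer` — a lattice-optimal modular parametrisation datum at level `N_{W₁}` (then `ord₂ ϖ = 0`: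
Česnavičius, `padicValRat_periodRatio_eq_zero_of_isOptimalDatum`) or `0 ≤ ord₂ ϖ` itself —: PRINT {`h41ns'`, `h41sp`, `hmod`,
`hGZK`, `hCassels`, `hC`, `h33g`, `hM`, `hA`, `hNS2`, `hBtors`} + MEMO {`hKato` K11a (RC-2), `hGS` (RC-4)} + CERTIFICATES ⟹
`MissingUpperBoundAt W 2` at every member (GEN 3's `missingUpperBoundAt_two_mult_of_towerGapMember'`).
[cite: GreenbergLNM1716, §3 pp. 85–94 and §4 pp. 112–113] [cite: Washington1997, §13.2] [cite: Cesnavicius2018, Thm. 1.2]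
[cite: Cassels1965ArithmeticVIII] [cite: Miller2011LMS, Def. 1.1] -/
theorem missingUpperBoundAt_two_mult_of_layerSelmer_cert_nonsplitTwo_of_goodPrime
    (hKato : ∀ (W : WeierstrassCurve ℚ) [W.IsElliptic] [W.IsGloballyMinimal],
      ¬ W.HasCM → Mult W 2 → O1.KatoMultiplicativeDivisibilityRat W 2)
    (h41ns' : thm41Analogue_charValue_rankZero_numberField_anyPrime_oddLocalDegree)
    (h41sp : thm41Analogue_charValue_rankZero_split_baseChange_anyPrime)
    (hmod : nonempty_modularParametrizationData)
    (hGZK : rank_eq_analyticRank_of_analyticRank_le_one)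
    (hCassels : bsdRHS_eq_of_isIsogenous)
    (hC : cesnavicius_not_two_dvd_maninConstant_of_two_dvd_level)
    (hGS : ∀ (W : WeierstrassCurve ℚ) [W.IsElliptic] [W.IsGloballyMinimal],
      W.HasSplitMultiplicativeReductionAtPrime 2 → greenberg_stevens (W := W) (p := 2))
    (h33g : lemma33_localTowerKerPrimary_eq_bot_of_good.{0})
    (hM : lemma33_localTowerKerPrimary_cyclic_of_multiplicative.{0})
    (hA : lemma33_natCard_localTowerKerPrimary_le_four_of_additive.{0})
    (hNS2 : sec3_natCard_localTowerKerPrimary_le_four_nonsplitMultiplicative_two)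
    (hBtors : finite_torsion_cyclotomicZpExtension)
    (W : WeierstrassCurve ℚ) [W.IsElliptic] [W.IsGloballyMinimal]
    (hr : W.analyticRank = 0) (hmult : Mult W 2)
    (W₁ : WeierstrassCurve ℚ) [W₁.IsElliptic] [W₁.IsGloballyMinimal] (hiso : IsIsogenous W W₁)
    (hPer : (∀ [NeZero (W₁.conductorNorm ℤ)],
        ∃ D : ModularParametrizationData W₁ (W₁.conductorNorm ℤ), Zhai2021.IsOptimalDatum W₁ D) ∨
      (∀ [NeZero (W₁.conductorNorm ℤ)] (f : CuspForm (Gamma0 (W₁.conductorNorm ℤ)) 2),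
        IsNewformOf W₁ f → ∀ ϖ : ℚ, (ϖ : ℝ) * W₁.realPeriodRat = plusPeriod f → 0 ≤ padicValRat 2 ϖ))
    (hmult₁ : W₁.HasMultiplicativeReductionAtPrime 2) (hns₁ : ¬ W₁.HasSplitMultiplicativeReductionAtPrime 2)
    (ℓ₀ : ℕ) [Fact ℓ₀.Prime] (h3 : 3 ≤ ℓ₀) (hgood : W₁.HasGoodReductionAtPrime ℓ₀) {t n : ℕ}
    (hn : W₁.reductionPointCount ℓ₀ = n) (hndvd : ¬ 2 ^ (t + 1) ∣ n) {j' a d : ℕ}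
    (P : Finset ℕ) (hP : ∀ ℓ ∈ P, ℓ.Prime ∧ ℓ ≠ 2)
    (hΔ : ∀ ℓ : ℕ, ℓ.Prime → ℓ ≠ 2 → (ℓ : ℤ) ∣ W₁.minimalDiscriminantInt → ℓ ∈ P)
    (C e k : ℕ → ℕ) (he : ∀ ℓ ∈ P, ¬ 2 ^ (e ℓ + 4) ∣ ℓ ^ 2 - 1)
    (hCℓ : ∀ (ℓ : ℕ) [Fact ℓ.Prime], ℓ ∈ P →
      4 ≤ C ℓ ∨ (W₁.HasMultiplicativeReductionAtPrime ℓ ∧ 2 ≤ C ℓ) ∨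
        (W₁.HasMultiplicativeReductionAtPrime ℓ ∧ (ℓ : ℤ) ^ k ℓ ∣ W₁.minimalDiscriminantInt ∧
          ¬ (ℓ : ℤ) ^ (k ℓ + 1) ∣ W₁.minimalDiscriminantInt ∧ ¬ 2 ∣ k ℓ ∧ 1 ≤ C ℓ) ∨
        (¬ (ℓ : ℤ) ∣ W₁.minimalDiscriminantInt ∧ 1 ≤ C ℓ))
    (hlow : ∀ κ : ZpExtension ℚ 2, κ.IsCyclotomic →
      2 ^ a ≤ Nat.card {z : W₁.selmerLayer κ 0 // 2 • z = 0})
    (hup : ∀ κ : ZpExtension ℚ 2, κ.IsCyclotomic →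
      Nat.card {z : W₁.selmerLayer κ j' // 2 • z = 0} ≤ 2 ^ d)
    (harith : 2 ^ (d + t) * 4 * ∏ ℓ ∈ P, C ℓ ^ 2 ^ min j' (e ℓ) < 2 ^ (2 ^ j' - 1 + a)) :
    MissingUpperBoundAt W 2 :=
  missingUpperBoundAt_two_mult_of_towerGapMember' hKato h41ns' h41sp hmod hGZK hCassels hC hGS W hr hmult W₁ hiso
    (towerGapAtTwo_of_layerSelmer_cert_nonsplitTwo_of_goodPrime W₁ h33g hM hA hNS2 hBtors hmult₁ hns₁ ℓ₀ h3 hgood hn hndvd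
      P hP hΔ C e k he hCℓ hlow hup harith)
    (Or.inr hPer)

/-- **ROAD (tower) for the CLASS at a SPLIT member with rational `2`-torsion.** As the non-split door with PRINT `hSP` in place of
`hNS2` and the Tate certificate at `W₁` (`Dq`, `log₂ q ≠ 0`, `ord₂(log₂ q) ≤ k_q + 2`); arithmetic with `C₂ = 2^{k_q}`.
[cite: GreenbergLNM1716, §3 pp. 85–94 and §4 pp. 112–113] [cite: Washington1997, §13.2] [cite: Cesnavicius2018, Thm. 1.2]
[cite: Cassels1965ArithmeticVIII] [cite: Miller2011LMS, Def. 1.1] -/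
theorem missingUpperBoundAt_two_mult_of_layerSelmer_cert_splitTwo_of_goodPrime
    (hKato : ∀ (W : WeierstrassCurve ℚ) [W.IsElliptic] [W.IsGloballyMinimal],
      ¬ W.HasCM → Mult W 2 → O1.KatoMultiplicativeDivisibilityRat W 2)
    (h41ns' : thm41Analogue_charValue_rankZero_numberField_anyPrime_oddLocalDegree)
    (h41sp : thm41Analogue_charValue_rankZero_split_baseChange_anyPrime)
    (hmod : nonempty_modularParametrizationData)
    (hGZK : rank_eq_analyticRank_of_analyticRank_le_one)
    (hCassels : bsdRHS_eq_of_isIsogenous)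
    (hC : cesnavicius_not_two_dvd_maninConstant_of_two_dvd_level)
    (hGS : ∀ (W : WeierstrassCurve ℚ) [W.IsElliptic] [W.IsGloballyMinimal],
      W.HasSplitMultiplicativeReductionAtPrime 2 → greenberg_stevens (W := W) (p := 2))
    (h33g : lemma33_localTowerKerPrimary_eq_bot_of_good.{0})
    (hM : lemma33_localTowerKerPrimary_cyclic_of_multiplicative.{0})
    (hA : lemma33_natCard_localTowerKerPrimary_le_four_of_additive.{0})
    (hSP : sec3_natCard_localTowerKerPrimary_splitMultiplicative_rat)
    (hBtors : finite_torsion_cyclotomicZpExtension)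
    (W : WeierstrassCurve ℚ) [W.IsElliptic] [W.IsGloballyMinimal]
    (hr : W.analyticRank = 0) (hmult : Mult W 2)
    (W₁ : WeierstrassCurve ℚ) [W₁.IsElliptic] [W₁.IsGloballyMinimal] (hiso : IsIsogenous W W₁)
    (hPer : (∀ [NeZero (W₁.conductorNorm ℤ)],
        ∃ D : ModularParametrizationData W₁ (W₁.conductorNorm ℤ), Zhai2021.IsOptimalDatum W₁ D) ∨
      (∀ [NeZero (W₁.conductorNorm ℤ)] (f : CuspForm (Gamma0 (W₁.conductorNorm ℤ)) 2),
        IsNewformOf W₁ f → ∀ ϖ : ℚ, (ϖ : ℝ) * W₁.realPeriodRat = plusPeriod f → 0 ≤ padicValRat 2 ϖ))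
    (Dq : TateParameterData W₁ 2) (hlog : padicLog 2 Dq.q ≠ 0) {kq : ℕ}
    (hkq : (padicLog 2 Dq.q).valuation ≤ (kq : ℤ) + 2)
    (ℓ₀ : ℕ) [Fact ℓ₀.Prime] (h3 : 3 ≤ ℓ₀) (hgood : W₁.HasGoodReductionAtPrime ℓ₀) {t n : ℕ}
    (hn : W₁.reductionPointCount ℓ₀ = n) (hndvd : ¬ 2 ^ (t + 1) ∣ n) {j' a d : ℕ}
    (P : Finset ℕ) (hP : ∀ ℓ ∈ P, ℓ.Prime ∧ ℓ ≠ 2)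
    (hΔ : ∀ ℓ : ℕ, ℓ.Prime → ℓ ≠ 2 → (ℓ : ℤ) ∣ W₁.minimalDiscriminantInt → ℓ ∈ P)
    (C e k : ℕ → ℕ) (he : ∀ ℓ ∈ P, ¬ 2 ^ (e ℓ + 4) ∣ ℓ ^ 2 - 1)
    (hCℓ : ∀ (ℓ : ℕ) [Fact ℓ.Prime], ℓ ∈ P →
      4 ≤ C ℓ ∨ (W₁.HasMultiplicativeReductionAtPrime ℓ ∧ 2 ≤ C ℓ) ∨
        (W₁.HasMultiplicativeReductionAtPrime ℓ ∧ (ℓ : ℤ) ^ k ℓ ∣ W₁.minimalDiscriminantInt ∧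
          ¬ (ℓ : ℤ) ^ (k ℓ + 1) ∣ W₁.minimalDiscriminantInt ∧ ¬ 2 ∣ k ℓ ∧ 1 ≤ C ℓ) ∨
        (¬ (ℓ : ℤ) ∣ W₁.minimalDiscriminantInt ∧ 1 ≤ C ℓ))
    (hlow : ∀ κ : ZpExtension ℚ 2, κ.IsCyclotomic →
      2 ^ a ≤ Nat.card {z : W₁.selmerLayer κ 0 // 2 • z = 0})
    (hup : ∀ κ : ZpExtension ℚ 2, κ.IsCyclotomic →
      Nat.card {z : W₁.selmerLayer κ j' // 2 • z = 0} ≤ 2 ^ d)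
    (harith : 2 ^ (d + t) * 2 ^ kq * ∏ ℓ ∈ P, C ℓ ^ 2 ^ min j' (e ℓ) < 2 ^ (2 ^ j' - 1 + a)) :
    MissingUpperBoundAt W 2 :=
  missingUpperBoundAt_two_mult_of_towerGapMember' hKato h41ns' h41sp hmod hGZK hCassels hC hGS W hr hmult W₁ hiso
    (towerGapAtTwo_of_layerSelmer_cert_splitTwo_of_goodPrime W₁ h33g hM hA hSP hBtors Dq hlog hkq ℓ₀ h3 hgood hn hndvd
      P hP hΔ C e k he hCℓ hlow hup harith)
    (Or.inr hPer)

end UpperHalf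

end Summit.BirchSwinnertonDyer.BirchSwinnertonDyer.Theorems.MultTowerTorsion

end
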